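import Literature.AlgebraicGeometry.Resolution.QuadraticTransformsStructure
import Literature.AlgebraicGeometry.Resolution.QuadraticTransformsFactorization
import Literature.AlgebraicGeometry.Resolution.QuadraticTransformWeakTransform
import HarnessLib

/-!
# [OURS · L1 W4.6 rung (i-a)] Thread chains, III: one quadratic transform along a valuation — charts of extreme value,
# the exceptional prime, the regular system of parameters `(ξ, η/ξ)`, and exactness of the order
# (cell res-hironaka, LADDER-RESOLUTION rung L, D-0089; campaign s46, prover res-L1-s46-pv-1; host route MarkedTransfer,
# `--supports stmt-ResolutionOfSingularities-16155`)

HONEST FRAMING. Nothing here is a statement of H. Hironaka's manuscript (2017-03-23, [Hironaka2017]). Pure commutative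
algebra inside a field `F`: structural facts about ONE quadratic transform `R → R₁` ALONG a valuation ring `O` of `F`
(`IsQuadraticTransformAlong`, tree `QuadraticTransforms.lean`) of a two-dimensional regular local ring `R` of `F`, in the
form consumed by the end game of the thread-chain proof of rung (i-a) (`MarkedTransferCampaignW46ThreadChain*.lean`);
classical facts (Zariski–Samuel II App. 5; Huneke–Swanson §14.2) assembled from the tree's chart algebra
(`QuadraticTransformsChart/WeakTransform/Factorization/Structure.lean`). AI review is weaker than expert review. No `sorry`.

## Contents

* `eq_locAtCentre_of_forall_le` — `R₁ = (R[𝔪/ξ])_{𝔪_O ∩ R[𝔪/ξ]}` for EVERY non-zero `ξ ∈ 𝔪_R` of extreme value;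
  `blowupRing_le_of_forall_le`, `div_mem_of_forall_le` (`η/ξ ∈ R₁`, a unit when `η` also has extreme value).
* `maximalIdeal_eq_span_pair` — **the satellite/rational step**: if `𝔪_R = (ξ, η)` with `ν(ξ) < ν(η)` then
  `𝔪_{R₁} = (ξ, η/ξ)`.
* `exists_maximalIdeal_eq_span_chart` — in general `𝔪_{R₁} = (x, f)` for the chart element `x` (tree
  `exists_eq_span_pair_of_map_maximalIdeal_le`), hence `prime_chart_succ`: `x ∉ 𝔪_{R₁}²` and `x` is a prime element of
  `R₁` generating a non-maximal prime, when `dim R₁ = 2`.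
* `div_pow_mem_and_not_dvd` — **exactness of the order**: for `z ∈ 𝔪_R^r ∖ 𝔪_R^{r+1}`, `z/x^r ∈ R₁` is not divisible
  by `x` (the strict transform is prime to the exceptional prime; tree `weakTransform_not_le_span`).

References: O. Zariski, P. Samuel, *Commutative Algebra* II (1960), App. 5 [ZariskiSamuel1960]; C. Huneke, I. Swanson,
*Integral Closure of Ideals, Rings, and Modules* (2006), §14.2, Thm. 14.5.2 [HunekeSwanson2006]; S. D. Cutkosky, Math. Ann. 362
(2015), §2.1–2.2 [Cutkosky2014].
-/

noncomputable section

set_option linter.dupNamespace false -- mandated namespace of this single-conjunct summit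

open IsLocalRing

namespace Summit.ResolutionOfSingularities.ResolutionOfSingularities.Theorems

namespace CampaignW46

open Literature.AlgebraicGeometry.Resolution

universe u

variable {F : Type u} [Field F]

section Step

variable {O : ValuationSubring F} {R R₁ : Subring F} [IsLocalRing R]

/-! ## Charts of extreme value -/

/-- **The transform along `O` is the local blowing up at ANY non-zero `ξ ∈ 𝔪_R` of extreme value** (uniqueness of the
transform along `O`, tree `IsQuadraticTransformAlong.unique`). [cite: Cutkosky2014, §2.2] -/
theorem eq_locAtCentre_of_forall_le (hst : IsQuadraticTransformAlong O R R₁) {ξ : F} (hξR : ξ ∈ R)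
    (hξm : (⟨ξ, hξR⟩ : R) ∈ maximalIdeal R) (hξ0 : ξ ≠ 0)
    (hmax : ∀ y ∈ maximalIdeal R, O.valuation (y : F) ≤ O.valuation ξ) :
    R₁ = locAtCentre (blowupRing R ξ) O := by
  classical
  obtain ⟨_, s, hs⟩ := hst.fg_maximalIdeal
  have hRO := hst.source_le
  have hspan : Ideal.span (↑(insert (⟨ξ, hξR⟩ : R) s) : Set R) = maximalIdeal R := by
    rw [Finset.coe_insert, Ideal.span_insert, hs, sup_eq_right]
    exact (Ideal.span_singleton_le_iff_mem _).mpr hξm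
  have h0 : (⟨ξ, hξR⟩ : R) ≠ 0 := fun e => hξ0 (congrArg Subtype.val e)
  have hval : ∀ y ∈ insert (⟨ξ, hξR⟩ : R) s, O.valuation (y : F) ≤ O.valuation (((⟨ξ, hξR⟩ : R) : F)) := by
    intro y hy
    have hym : y ∈ maximalIdeal R := by rw [← hspan]; exact Ideal.subset_span (Finset.mem_coe.mpr hy)
    exact hmax y hym
  have heq : locAtCentre (blowupRing R ξ) O =
      locAtCentre (Subring.closure ((R : Set F) ∪ (fun y : R => (y : F) / ((⟨ξ, hξR⟩ : R) : F)) '' ↑(insert (⟨ξ, hξR⟩ : R) s))) O := by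
    rw [← blowupRing_eq_closure_of_span_eq _ _ hspan]
  have hblow : IsLocalBlowupAlong O R (maximalIdeal R) (locAtCentre (blowupRing R ξ) O) := by
    -- (the witnesses first, then the fields one by one: the one-shot anonymous constructor times out)
    refine ⟨hRO, insert ⟨ξ, hξR⟩ s, ⟨ξ, hξR⟩, ?_, ?_, ?_, ?_, ?_⟩
    exacts [hspan, Finset.mem_insert_self _ _, h0, hval, heq]
  have h' : IsQuadraticTransformAlong O R (locAtCentre (blowupRing R ξ) O) := ⟨inferInstance, hblow⟩
  exact hst.unique h'

/-- `R[𝔪/ξ] ⊆ R₁` for every non-zero `ξ ∈ 𝔪_R` of extreme value. [cite: Cutkosky2014, §2.2] -/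
theorem blowupRing_le_of_forall_le (hst : IsQuadraticTransformAlong O R R₁) {ξ : F} (hξR : ξ ∈ R)
    (hξm : (⟨ξ, hξR⟩ : R) ∈ maximalIdeal R) (hξ0 : ξ ≠ 0)
    (hmax : ∀ y ∈ maximalIdeal R, O.valuation (y : F) ≤ O.valuation ξ) :
    blowupRing R ξ ≤ R₁ := by
  rw [eq_locAtCentre_of_forall_le hst hξR hξm hξ0 hmax]
  exact le_locAtCentre _ O

/-- For `ξ` of extreme value and `η ∈ 𝔪_R`: `η/ξ ∈ R₁`. [folklore] -/
theorem div_mem_of_forall_le (hst : IsQuadraticTransformAlong O R R₁) {ξ : F} (hξR : ξ ∈ R)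
    (hξm : (⟨ξ, hξR⟩ : R) ∈ maximalIdeal R) (hξ0 : ξ ≠ 0)
    (hmax : ∀ y ∈ maximalIdeal R, O.valuation (y : F) ≤ O.valuation ξ) {η : F} (hηR : η ∈ R)
    (hηm : (⟨η, hηR⟩ : R) ∈ maximalIdeal R) : η / ξ ∈ R₁ :=
  blowupRing_le_of_forall_le hst hξR hξm hξ0 hmax (div_mem_blowupRing ξ hηm)

/-- Two elements of extreme value have a quotient which is a UNIT of `R₁`. [folklore] -/
theorem isUnit_div_of_forall_le (hst : IsQuadraticTransformAlong O R R₁) {ξ η : F} (hξR : ξ ∈ R) (hηR : η ∈ R)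
    (hξm : (⟨ξ, hξR⟩ : R) ∈ maximalIdeal R) (hηm : (⟨η, hηR⟩ : R) ∈ maximalIdeal R) (hξ0 : ξ ≠ 0) (hη0 : η ≠ 0)
    (hξmax : ∀ y ∈ maximalIdeal R, O.valuation (y : F) ≤ O.valuation ξ)
    (hηmax : ∀ y ∈ maximalIdeal R, O.valuation (y : F) ≤ O.valuation η) :
    IsUnit (⟨η / ξ, div_mem_of_forall_le hst hξR hξm hξ0 hξmax hηR hηm⟩ : R₁) := by
  rw [isUnit_subring_iff_inv_mem]
  refine ⟨div_ne_zero hη0 hξ0, ?_⟩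
  change (η / ξ)⁻¹ ∈ R₁
  rw [inv_div]
  exact div_mem_of_forall_le hst hηR hηm hη0 hηmax hξR hξm

/-- A member of the chain dominated by `O`: an element of `R₁` of value `1` is a unit, i.e. its inverse lies in `R₁`.
[folklore] -/
theorem inv_mem_of_valuation_eq_one (hdom : SubringDominates R₁ O.toSubring) {z : F} (hz : z ∈ R₁)
    (hv : O.valuation z = 1) : z⁻¹ ∈ R₁ := by
  refine hdom.2 z hz ?_
  change z⁻¹ ∈ O
  rw [← O.valuation_le_one_iff, map_inv₀, hv, inv_one]

/-! ## The regular system of parameters `(ξ, η/ξ)` when `ν(ξ) < ν(η)` -/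

/-- **The rational/satellite step.** If `𝔪_R = (ξ, η)` and `ν(ξ) < ν(η)` (that is, `η/ξ` lies in the maximal ideal of
`O`), then `𝔪_{R₁} = (ξ, η/ξ)`: every element of the centre of `O` on `R[η/ξ]` is `p(η/ξ)` with `p(0) ∈ 𝔪_R = (ξ, η)`.
[cite: HunekeSwanson2006, §14.2 (p. 264)] -/
theorem maximalIdeal_eq_span_pair [IsLocalRing R₁] (hst : IsQuadraticTransformAlong O R R₁)
    (hRdom : SubringDominates R O.toSubring) (hdom : SubringDominates R₁ O.toSubring) {ξ η : F} (hξR : ξ ∈ R) (hηR : η ∈ R)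
    (hm : maximalIdeal R = Ideal.span {⟨ξ, hξR⟩, ⟨η, hηR⟩}) (hξ0 : ξ ≠ 0)
    (hlt : O.valuation (η / ξ) < 1) :
    ∃ (hξ1 : ξ ∈ R₁) (ht1 : η / ξ ∈ R₁), maximalIdeal R₁ = Ideal.span {⟨ξ, hξ1⟩, ⟨η / ξ, ht1⟩} := by
  classical
  have hRO := hst.source_le
  have hR₁O := hst.target_le
  have hξO : O.valuation ξ ≤ 1 := (O.valuation_le_one_iff _).mpr (hRO hξR)
  -- `ξ` has extreme value: `𝔪 = (ξ, η)` and `ν(η) > ν(ξ)`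
  have hvηξ : O.valuation η < O.valuation ξ := by
    have hvξ0 : 0 < O.valuation ξ := pos_iff_ne_zero.mpr ((map_ne_zero _).mpr hξ0)
    rw [map_div₀, div_lt_one₀ hvξ0] at hlt
    exact hlt
  have hξm : (⟨ξ, hξR⟩ : R) ∈ maximalIdeal R := hm ▸ Ideal.subset_span (Set.mem_insert _ _)
  have hηm : (⟨η, hηR⟩ : R) ∈ maximalIdeal R := hm ▸ Ideal.subset_span (Set.mem_insert_of_mem _ rfl)
  have hmax : ∀ y ∈ maximalIdeal R, O.valuation (y : F) ≤ O.valuation ξ := by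
    intro y hy
    rw [hm, Ideal.mem_span_pair] at hy
    obtain ⟨a, c, rfl⟩ := hy
    simp only [Subring.coe_add, Subring.coe_mul]
    refine (Valuation.map_add _ _ _).trans (max_le ?_ ?_)
    · rw [map_mul]
      calc O.valuation (a : F) * O.valuation ξ ≤ 1 * O.valuation ξ :=
            mul_le_mul' ((O.valuation_le_one_iff _).mpr (hRO a.2)) le_rfl
        _ = O.valuation ξ := one_mul _
    · rw [map_mul]
      calc O.valuation (c : F) * O.valuation η ≤ 1 * O.valuation ξ :=
            mul_le_mul' ((O.valuation_le_one_iff _).mpr (hRO c.2)) hvηξ.le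
        _ = O.valuation ξ := one_mul _
  have hA : blowupRing R ξ ≤ R₁ := blowupRing_le_of_forall_le hst hξR hξm hξ0 hmax
  have hξ1 : ξ ∈ R₁ := hst.le hξR
  have ht1 : η / ξ ∈ R₁ := hA (div_mem_blowupRing ξ hηm)
  refine ⟨hξ1, ht1, le_antisymm ?_ ?_⟩
  · -- `⊆`: an element of `𝔪_{R₁}` is `a/s` with `a, s ∈ R[η/ξ]`, `ν(s) = 0`, `ν(a) > 0`
    set I : Ideal R₁ := Ideal.span {⟨ξ, hξ1⟩, ⟨η / ξ, ht1⟩} with hI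
    have hR₁eq := eq_locAtCentre_of_forall_le hst hξR hξm hξ0 hmax
    -- the centre of `O` on `R[η/ξ]` lies in `(ξ, η/ξ) R₁`
    have key : ∀ a : F, ∀ ha : a ∈ blowupRing R ξ, O.valuation a < 1 → (⟨a, hA ha⟩ : R₁) ∈ I := by
      intro a ha hva
      have ha2 := ha
      rw [blowupRing_eq_adjoin hm] at ha2
      obtain ⟨p, hp⟩ := exists_aeval_eq_of_mem_adjoin (R := R) (u := η / ξ) ha2
      obtain ⟨q, hq⟩ := Polynomial.X_dvd_sub_C (p := p)
      have hsplit : a = ((p.coeff 0 : R) : F) + η / ξ * Polynomial.aeval (η / ξ) q := by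
        have e := congrArg (Polynomial.aeval (η / ξ)) hq
        rw [map_sub, Polynomial.aeval_C, map_mul, Polynomial.aeval_X, hp] at e
        change a - ((p.coeff 0 : R) : F) = _ at e
        linear_combination e
      have hqt : Polynomial.aeval (η / ξ) q ∈ R₁ :=
        hA (by rw [blowupRing_eq_adjoin hm]; exact Subalgebra.mem_toSubring.mpr (Polynomial.aeval_mem_adjoin_singleton R _))
      -- `p(0) ∈ 𝔪_R`: otherwise `ν(a) = 1`
      have hp0m : p.coeff 0 ∈ maximalIdeal R := by
        by_contra hunit
        have hv0 : O.valuation ((p.coeff 0 : R) : F) = 1 := by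
          rw [mem_maximalIdeal_iff_inv_not_mem] at hunit
          push Not at hunit
          have h1 : O.valuation ((p.coeff 0 : R) : F) ≤ 1 := (O.valuation_le_one_iff _).mpr (hRO (p.coeff 0).2)
          have h2 : O.valuation (((p.coeff 0 : R) : F))⁻¹ ≤ 1 := (O.valuation_le_one_iff _).mpr (hRO hunit.2)
          rw [map_inv₀, inv_le_one₀ (pos_iff_ne_zero.mpr ((map_ne_zero _).mpr hunit.1))] at h2
          exact le_antisymm h1 h2
        have hvw : O.valuation (η / ξ * Polynomial.aeval (η / ξ) q) < 1 := by
          rw [map_mul]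
          calc O.valuation (η / ξ) * O.valuation (Polynomial.aeval (η / ξ) q : F)
              ≤ O.valuation (η / ξ) * 1 :=
                mul_le_mul' le_rfl ((O.valuation_le_one_iff _).mpr (hR₁O hqt))
            _ < 1 := by rw [mul_one]; exact hlt
        have hadd := Valuation.map_add_eq_of_lt_left (v := O.valuation) (x := ((p.coeff 0 : R) : F))
          (y := η / ξ * Polynomial.aeval (η / ξ) q) (by rw [hv0]; exact hvw)
        have : O.valuation a = 1 := by rw [hsplit, hadd, hv0]
        exact absurd this hva.ne
      -- `p(0) = αξ + βη = αξ + (βξ)(η/ξ)`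
      rw [hm, Ideal.mem_span_pair] at hp0m
      obtain ⟨α, β, hαβ⟩ := hp0m
      have ha' : (⟨a, hA ha⟩ : R₁) =
          ⟨(α : F), hst.le α.2⟩ * ⟨ξ, hξ1⟩ +
            (⟨(β : F), hst.le β.2⟩ * ⟨ξ, hξ1⟩ + ⟨Polynomial.aeval (η / ξ) q, hqt⟩) * ⟨η / ξ, ht1⟩ := by
        apply Subtype.ext
        simp only [Subring.coe_add, Subring.coe_mul]
        rw [hsplit, ← hαβ]
        simp only [Subring.coe_add, Subring.coe_mul]
        field_simp
        ring
      rw [ha', hI, Ideal.mem_span_pair]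
      exact ⟨_, _, rfl⟩
    intro z hz
    have hzval : O.valuation (z : F) < 1 := ((subringDominates_valuationSubring_iff hR₁O).mp hdom z).mp hz
    have hzmem : (z : F) ∈ locAtCentre (blowupRing R ξ) O := hR₁eq ▸ z.2
    obtain ⟨a, ha, s, hs, hvs, hz'⟩ := mem_locAtCentre_iff.mp hzmem
    have hsinv : s⁻¹ ∈ R₁ := inv_mem_of_valuation_eq_one hdom (hA hs) hvs
    have hva : O.valuation a < 1 := by
      have : O.valuation (z : F) = O.valuation a := by rw [hz', map_div₀, hvs, div_one]
      rwa [this] at hzval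
    have : z = ⟨a, hA ha⟩ * ⟨s⁻¹, hsinv⟩ := Subtype.ext (by rw [Subring.coe_mul]; exact hz'.trans (div_eq_mul_inv _ _))
    rw [this]
    exact Ideal.mul_mem_right _ _ (key a ha hva)
  · have h1 : ∀ w : R₁, O.valuation (w : F) < 1 → w ∈ maximalIdeal R₁ := fun w hw =>
      ((subringDominates_valuationSubring_iff hR₁O).mp hdom w).mpr hw
    have hvξ : O.valuation ξ < 1 := ((subringDominates_valuationSubring_iff hRO).mp hRdom ⟨ξ, hξR⟩).mp hξm
    rw [Ideal.span_le]
    intro w hw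
    rcases hw with hw | hw
    · rw [hw]; exact h1 _ hvξ
    · rw [Set.mem_singleton_iff] at hw
      rw [hw]; exact h1 _ hlt

end Step

section Regular

variable {O : ValuationSubring F} {R R₁ : Subring F} [IsRegularLocalRing R]

/-! ## The exceptional prime: `𝔪_{R₁} = (x, f)`, `x ∉ 𝔪_{R₁}²`, `x` prime in `R₁` -/

/-- **`𝔪_{R₁} = (x, f)` for the chart element `x`** (a non-zero `x ∈ 𝔪_R` of extreme value): the primes of `R[𝔪/x]`
over the exceptional prime `x R[𝔪/x]` are `(x, f)` (tree `exists_eq_span_pair_of_map_maximalIdeal_le`), and `R₁` is the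
localization at the centre of `O`. [cite: HunekeSwanson2006, §14.2 (p. 264)] -/
theorem exists_maximalIdeal_eq_span_chart (hdim : ringKrullDim R = 2) [IsLocalRing R₁]
    (hst : IsQuadraticTransformAlong O R R₁) (hRdom : SubringDominates R O.toSubring) {x : R}
    (hxm : x ∈ maximalIdeal R) (hx0 : x ≠ 0)
    (hmax : ∀ y ∈ maximalIdeal R, O.valuation (y : F) ≤ O.valuation (x : F)) :
    ∃ (hx1 : (x : F) ∈ R₁) (f : R₁), maximalIdeal R₁ = Ideal.span {⟨x, hx1⟩, f} := by
  classical
  have hRO := hst.source_le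
  have hRR₁ : SubringDominates R R₁ := (hst.isQuadraticTransform hRdom).dominates
  have hx0F : (x : F) ≠ 0 := fun e => hx0 (Subtype.ext e)
  have hT : blowupRing R (x : F) ≤ R₁ := blowupRing_le_of_forall_le hst x.2 (by simpa using hxm) hx0F hmax
  have hx2 : x ∉ maximalIdeal R ^ 2 := IsQuadraticTransform.chart_not_mem_sq hT hRR₁ hx0
  obtain ⟨y, hm, -, -⟩ := exists_maximalIdeal_eq_span_pair_of_not_mem_sq hdim hxm hx2
  have hA : blowupRing R (x : F) = chartAdjoin (K := F) x y := blowupRing_eq_adjoin hm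
  have hAR₁ : chartAdjoin (K := F) x y ≤ R₁ := hA.ge.trans hT
  have hAO : chartAdjoin (K := F) x y ≤ O.toSubring := hAR₁.trans hst.target_le
  have hR₁eq : R₁ = (LocalSubring.ofPrime (chartAdjoin (K := F) x y)
      (subringCentre (chartAdjoin (K := F) x y) O hAO)).toSubring := by
    rw [eq_locAtCentre_of_forall_le hst x.2 (by simpa using hxm) hx0F hmax, hA, locAtCentre_eq_ofPrime hAO]
  -- `𝔪_R A ⊆ Q` (domination by `O`)
  have h𝔭Q : (maximalIdeal R).map (chartIncl (K := F) x y) ≤ subringCentre (chartAdjoin (K := F) x y) O hAO := by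
    rw [Ideal.map_le_iff_le_comap]
    intro r hr
    rw [Ideal.mem_comap, mem_subringCentre_iff]
    exact ((subringDominates_valuationSubring_iff hRO).mp hRdom r).mp hr
  obtain ⟨f, hQf⟩ := exists_eq_span_pair_of_map_maximalIdeal_le hm hx0 rfl h𝔭Q
  subst hR₁eq
  set Q := subringCentre (chartAdjoin (K := F) x y) O hAO with hQdef
  refine ⟨hAR₁ (chartIncl (K := F) x y x).2, algebraMap (chartAdjoin (K := F) x y) _ f, ?_⟩
  have e : Q.map (algebraMap _ (LocalSubring.ofPrime (chartAdjoin (K := F) x y) Q).toSubring) =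
      (Ideal.span {chartIncl (K := F) x y x, f}).map
        (algebraMap _ (LocalSubring.ofPrime (chartAdjoin (K := F) x y) Q).toSubring) :=
    congrArg (Ideal.map (algebraMap _ _)) hQf
  rw [← IsLocalization.AtPrime.map_eq_maximalIdeal Q (LocalSubring.ofPrime (chartAdjoin (K := F) x y) Q).toSubring,
    e, Ideal.map_span, Set.image_insert_eq, Set.image_singleton]
  rfl

/-- **The exceptional prime in a two-dimensional `R₁`**: the chart element `x` is a prime element of `R₁`, generates a
non-maximal prime, and `x ∉ 𝔪_{R₁}²` (so `ord_{R₁} x = 1`). [cite: HunekeSwanson2006, Thm. 14.5.2 (proof)] -/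
theorem prime_chart_succ (hdim : ringKrullDim R = 2) [IsRegularLocalRing R₁]
    (hdim₁ : ringKrullDim R₁ = 2) (hst : IsQuadraticTransformAlong O R R₁) (hRdom : SubringDominates R O.toSubring)
    {x : R} (hxm : x ∈ maximalIdeal R) (hx0 : x ≠ 0)
    (hmax : ∀ y ∈ maximalIdeal R, O.valuation (y : F) ≤ O.valuation (x : F)) :
    ∃ hx1 : (x : F) ∈ R₁, Prime (⟨x, hx1⟩ : R₁) ∧ (⟨x, hx1⟩ : R₁) ∉ maximalIdeal R₁ ^ 2 ∧
      Ideal.span {(⟨x, hx1⟩ : R₁)} ≠ maximalIdeal R₁ ∧ (⟨x, hx1⟩ : R₁) ∈ maximalIdeal R₁ := by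
  obtain ⟨hx1, f, hmf⟩ := exists_maximalIdeal_eq_span_chart hdim hst hRdom hxm hx0 hmax
  have hx2 : (⟨x, hx1⟩ : R₁) ∉ maximalIdeal R₁ ^ 2 := fst_not_mem_sq hdim₁ hmf
  have hxm1 : (⟨x, hx1⟩ : R₁) ∈ maximalIdeal R₁ := hmf ▸ Ideal.subset_span (Set.mem_insert _ _)
  obtain ⟨-, -, hprime, -⟩ := exists_maximalIdeal_eq_span_pair_of_not_mem_sq hdim₁ hxm1 hx2
  exact ⟨hx1, hprime, hx2, (maximalIdeal_ne_span_singleton hdim₁ _).symm, hxm1⟩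

/-! ## Exactness of the order -/

/-- **Exactness of the order along the chart**: if `𝔪_R = (x, y)` and `z ∈ 𝔪_R^r ∖ 𝔪_R^{r+1}` then the strict transform
`z / x^r` lies in `R₁` and is NOT divisible by `x` there (the order valuation of `R` is the `x`-adic valuation of `R₁`;
tree `weakTransform_not_le_span` on the chart, then localization at the centre). [cite: ZariskiSamuel1960, Appendix 5] -/
theorem div_pow_mem_and_not_dvd (hdim : ringKrullDim R = 2) [IsLocalRing R₁]
    (hst : IsQuadraticTransformAlong O R R₁) (hRdom : SubringDominates R O.toSubring)
    {x y : R} (hm : maximalIdeal R = Ideal.span {x, y})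
    (hmax : ∀ w ∈ maximalIdeal R, O.valuation (w : F) ≤ O.valuation (x : F))
    {z : R} {r : ℕ} (hzr : z ∈ maximalIdeal R ^ r) (hzr1 : z ∉ maximalIdeal R ^ (r + 1)) :
    ∃ hmem : (z : F) / (x : F) ^ r ∈ R₁, ∀ hx1 : (x : F) ∈ R₁,
      ¬ (⟨(x : F), hx1⟩ : R₁) ∣ ⟨(z : F) / (x : F) ^ r, hmem⟩ := by
  classical
  have hRO := hst.source_le
  have hxm : x ∈ maximalIdeal R := hm ▸ Ideal.subset_span (Set.mem_insert _ _)
  have hx2 : x ∉ maximalIdeal R ^ 2 := fst_not_mem_sq hdim hm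
  have hx0 : x ≠ 0 := by rintro rfl; exact hx2 (Ideal.zero_mem _)
  have hx0F : (x : F) ≠ 0 := fun e => hx0 (Subtype.ext e)
  set A := chartAdjoin (K := F) x y with hAdef
  have hA : blowupRing R (x : F) = A := blowupRing_eq_adjoin hm
  have hT : blowupRing R (x : F) ≤ R₁ := blowupRing_le_of_forall_le hst x.2 (by simpa using hxm) hx0F hmax
  have hAR₁ : A ≤ R₁ := hA.ge.trans hT
  have hAO : A ≤ O.toSubring := hAR₁.trans hst.target_le
  -- `z = x^r a` on the chart
  have hzle : (Ideal.span {z}).map (chartIncl (K := F) x y) ≤ Ideal.span {chartIncl x y x ^ r} :=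
    map_chartIncl_le_span_pow hm hx0 ((Ideal.span_singleton_le_iff_mem _).mpr hzr)
  have hzmem : chartIncl (K := F) x y z ∈ Ideal.span {chartIncl x y x ^ r} :=
    hzle (Ideal.mem_map_of_mem _ (Ideal.mem_span_singleton_self z))
  obtain ⟨a, ha⟩ := Ideal.mem_span_singleton'.mp hzmem
  have haval : (a : F) = (z : F) / (x : F) ^ r := by
    have e := congrArg Subtype.val ha
    simp only [Subring.coe_mul, SubmonoidClass.coe_pow, Subring.coe_inclusion] at e
    rw [eq_div_iff (pow_ne_zero r hx0F)]
    exact e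
  have hmem : (z : F) / (x : F) ^ r ∈ R₁ := haval ▸ hAR₁ a.2
  refine ⟨hmem, fun hx1 hdvd => ?_⟩
  -- the weak transform of `(z)` on the chart is `(a)`; it is not inside `(x)`
  have hnot := weakTransform_not_le_span (K := F) hdim hm hx0 ((Ideal.span_singleton_le_iff_mem _).mpr hzr)
    (by rwa [Ideal.span_singleton_le_iff_mem])
  apply hnot
  -- from `x ∣ z/x^r` in `R₁ = A_Q`: `a s = x a'` with `s ∉ Q ⊇ xA`, `xA` prime, so `a ∈ xA`
  obtain ⟨w, hw⟩ := hdvd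
  set Q : Ideal A := subringCentre A O hAO with hQdef
  have hR₁eq : R₁ = (LocalSubring.ofPrime A Q).toSubring := by
    rw [eq_locAtCentre_of_forall_le hst x.2 (by simpa using hxm) hx0F hmax, hA, locAtCentre_eq_ofPrime hAO]
  have hwmem : (w : F) ∈ (LocalSubring.ofPrime A Q).toSubring := hR₁eq ▸ w.2
  obtain ⟨a', s, hs, hw'⟩ := mem_ofPrime_iff.mp hwmem
  have hym : y ∈ maximalIdeal R := hm ▸ Ideal.subset_span (Set.mem_insert_of_mem _ rfl)
  have hxy : ∀ t : R, x ∣ y * t → x ∣ t := by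
    obtain ⟨y', -, hprime, -⟩ := exists_maximalIdeal_eq_span_pair_of_not_mem_sq hdim hxm hx2
    have hxny : ¬ x ∣ y := by
      intro hxy
      apply maximalIdeal_ne_span_singleton hdim x
      rw [hm]
      apply le_antisymm
      · rw [Ideal.span_le]
        intro t ht
        rcases ht with ht | ht
        · rw [ht]; exact Ideal.mem_span_singleton_self _
        · rw [Set.mem_singleton_iff] at ht
          rw [ht]; exact Ideal.mem_span_singleton.mpr hxy
      · exact Ideal.span_mono (Set.singleton_subset_iff.mpr (Set.mem_insert _ _))
    intro t ht
    exact (hprime.dvd_or_dvd ht).resolve_left hxny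
  haveI h𝔭 : ((maximalIdeal R).map (chartIncl (K := F) x y)).IsPrime := isPrime_map_incl (K := F) hx0 hxy hxm hym
  have h𝔭eq : (maximalIdeal R).map (chartIncl (K := F) x y) = Ideal.span {chartIncl x y x} := by
    rw [hm]; exact map_incl_span_pair hx0 y
  have h𝔭Q : (maximalIdeal R).map (chartIncl (K := F) x y) ≤ Q := by
    rw [Ideal.map_le_iff_le_comap]
    intro t ht
    rw [Ideal.mem_comap, hQdef, mem_subringCentre_iff]
    exact ((subringDominates_valuationSubring_iff hRO).mp hRdom t).mp ht
  have hsQ : s ∉ (maximalIdeal R).map (chartIncl (K := F) x y) := fun hs' => hs (h𝔭Q hs')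
  -- `a * s = x * a'` in `A`
  have heq : a * s = chartIncl x y x * a' := by
    apply Subtype.ext
    simp only [Subring.coe_mul, Subring.coe_inclusion]
    have hs0 : ((s : A) : F) ≠ 0 := coe_ne_zero_of_not_mem (K := F) hs
    have e1 := congrArg Subtype.val hw
    simp only [Subring.coe_mul] at e1
    -- e1 : z/x^r = x * w, hw' : w = a'/s
    change (z : F) / (x : F) ^ r = (x : F) * (w : F) at e1
    rw [haval, e1, hw']
    field_simp
  have hmem𝔭 : a * s ∈ (maximalIdeal R).map (chartIncl (K := F) x y) := by
    rw [h𝔭eq, heq]; exact Ideal.mul_mem_right _ _ (Ideal.mem_span_singleton_self _)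
  have ha𝔭 : a ∈ Ideal.span {chartIncl (K := F) x y x} :=
    h𝔭eq ▸ ((h𝔭.mem_or_mem hmem𝔭).resolve_right hsQ)
  -- hence the weak transform `((z) A : x^r) ⊆ (x)`
  intro c hc
  rw [Submodule.mem_colon_singleton, Ideal.map_span, Set.image_singleton, smul_eq_mul] at hc
  obtain ⟨d, hd⟩ := Ideal.mem_span_singleton'.mp hc
  -- `d * z = c * x^r`, `z = a x^r` ⇒ `c = d a`
  have hc' : c = d * a := by
    have hx0A : chartIncl (K := F) x y x ^ r ≠ 0 :=
      pow_ne_zero r fun e => hx0 (chartIncl_injective x y (by rw [e, map_zero]))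
    apply mul_right_cancel₀ hx0A
    rw [← hd, ← ha]; ring
  rw [hc']
  exact Ideal.mul_mem_left _ _ ha𝔭

end Regular

end CampaignW46

end Summit.ResolutionOfSingularities.ResolutionOfSingularities.Theorems

end
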